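import Summits.ValiantsHypothesis.ValiantsHypothesis.Theorems.BinomialElusivePeelingLemmaArmRigid
import Summits.ValiantsHypothesis.ValiantsHypothesis.Theorems.BinomialElusivePeelingLemmaRigidityTail

/-!
# One arm of the `S⁻` analysis, concluded: trivial centre ⇒ `d ≡ 0`; non-trivial centre ⇒ the centre is old

Helper for the crux stmt-ValiantsHypothesis-7391 (negative lane; `Cruxes/PeelingLemma/DETERMINISTIC-ALLX.md`
§3g STEP 3 / §3h (E4)).  For one arm with antisymmetric content `d` (zero from `M` on, every window
of `2q` consecutive edges of mass `≤ ℓ < 2q`) whose `S⁻` private readings vanish off the class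
`v (mod 2q+1)` of the spider centre: writing `P s = Σ_{t∈[1,s]} (-1)^t (d t - d (t-1))`,
* Case A (`1 ≤ v ≤ 2q`): if the centre reading `P v` vanishes then `d ≡ 0` (`arm_trivial_caseA`); if it
  does not, the arm pays `2v+1 ≤ ℓ` (`two_mul_add_one_le_of_caseA`), so `v ≤ (ℓ-1)/2` — the centre is
  OLD on this arm;
* Case B (`v = 0`, the centre is the arm's oldest letter): if `d 0 = 0` then `d ≡ 0` (`arm_trivial_caseB`).
Pointwise hypotheses; no windows; no Theses import.
-/

namespace Summit.ValiantsHypothesis.ValiantsHypothesis.Theorems.PeelingLemmaRigidity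

-- summit = sub-problem name (single-conjunct summit, D-0017 layout), so the namespace repeats it
set_option linter.dupNamespace false

open scoped BigOperators
open Finset

/-- Flatness of every window from the mass bound. -/
theorem flat_all_of_mass {q ℓ : ℕ} (hℓ : ℓ < 2 * q) (d : ℕ → ℤ)
    (hmass : ∀ a, ∑ t ∈ Finset.Ico a (a + 2 * q), |d t| ≤ ℓ) (a : ℕ)
    (hc : ∀ t, a ≤ t → t ≤ a + 2 * q - 1 → d t = d a) : d a = 0 :=
  flat_zero_of_small_mass (q := q) d (lt_of_le_of_lt (hmass a) (by exact_mod_cast hℓ))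
    (fun t h1 h2 => hc t h1 (by omega))

/-- **Case A, trivial centre ⇒ trivial arm.** -/
theorem arm_trivial_caseA {q v M ℓ : ℕ} (hq : 1 ≤ q) (hv1 : 1 ≤ v) (hv2 : v ≤ 2 * q) (hℓ : ℓ < 2 * q)
    (d : ℕ → ℤ) (hdM : ∀ t, M ≤ t → d t = 0)
    (hmass : ∀ a, ∑ t ∈ Finset.Ico a (a + 2 * q), |d t| ≤ ℓ)
    (hread : ∀ t₀, 1 ≤ t₀ → t₀ ≤ M → (t₀ - 1) % (2 * q + 1) ≠ v →
      ∑ t ∈ Finset.Icc t₀ (t₀ + 2 * q), (-1 : ℤ) ^ (t - t₀) * (d t - d (t - 1)) = 0)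
    (htriv : ∑ t ∈ Finset.Icc 1 v, (-1 : ℤ) ^ t * (d t - d (t - 1)) = 0) : ∀ t, d t = 0 := by
  obtain ⟨hconst, hper⟩ := arm_periodic (q := q) (v := v) d hdM hread
  set P : ℕ → ℤ := fun s => ∑ t ∈ Finset.Icc 1 s, (-1 : ℤ) ^ t * (d t - d (t - 1)) with hPdef
  have hPg : ∀ t, 1 ≤ t → P t - P (t - 1) = (-1) ^ t * (d t - d (t - 1)) := fun t ht => prefix_succ d t ht
  have h := rigid_caseA (q := q) (v := v) (M := M) hv1 hv2 P (fun t => d t - d (t - 1)) d (P M)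
    (by simp [hPdef]) hconst hper hPg (fun t _ => rfl)
    (fun hc => flat_all_of_mass hℓ d hmass (v + 1) (fun t h1 h2 => hc t h1 (by omega)))
  obtain ⟨hc0, -, hdlow, hd0, hdv, -⟩ := h
  have hoff : ∀ s, s % (2 * q + 1) ≠ v → P s = 0 := fun s hs => by
    rw [eq_const_of_offclass P (P M) hconst hper s hs, hc0]
  have htail := rigid_tail hq hv2 P (fun t => d t - d (t - 1)) d 0 hoff hPg (fun t _ => rfl)
    (fun k hc => flat_all_of_mass hℓ d hmass _ (fun t h1 h2 => hc t h1 (by omega)))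
  have hPv : P v = 0 := htriv
  intro t
  rcases Nat.lt_or_ge t v with ht | ht
  · rw [hdlow t ht, hd0, hPv, mul_zero]
  · rcases Nat.eq_or_lt_of_le ht with ht' | ht'
    · rw [← ht', hdv, hPv, mul_zero, neg_zero]
    · exact htail.2 t (by omega)

/-- **Case B, trivial centre ⇒ trivial arm.** -/
theorem arm_trivial_caseB {q M ℓ : ℕ} (hq : 1 ≤ q) (hℓ : ℓ < 2 * q) (d : ℕ → ℤ)
    (hdM : ∀ t, M ≤ t → d t = 0)
    (hmass : ∀ a, ∑ t ∈ Finset.Ico a (a + 2 * q), |d t| ≤ ℓ)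
    (hread : ∀ t₀, 1 ≤ t₀ → t₀ ≤ M → (t₀ - 1) % (2 * q + 1) ≠ 0 →
      ∑ t ∈ Finset.Icc t₀ (t₀ + 2 * q), (-1 : ℤ) ^ (t - t₀) * (d t - d (t - 1)) = 0)
    (htriv : d 0 = 0) : ∀ t, d t = 0 := by
  obtain ⟨hconst, hper⟩ := arm_periodic (q := q) (v := 0) d hdM hread
  set P : ℕ → ℤ := fun s => ∑ t ∈ Finset.Icc 1 s, (-1 : ℤ) ^ t * (d t - d (t - 1)) with hPdef
  have hPg : ∀ t, 1 ≤ t → P t - P (t - 1) = (-1) ^ t * (d t - d (t - 1)) := fun t ht => prefix_succ d t ht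
  have h := rigid_caseB (q := q) (M := M) hq P (fun t => d t - d (t - 1)) d (P M)
    (by simp [hPdef]) hconst hper hPg (fun t _ => rfl)
    (fun hc => flat_all_of_mass hℓ d hmass 1 (fun t h1 h2 => hc t h1 (by omega)))
  have hoff : ∀ s, s % (2 * q + 1) ≠ 0 → P s = 0 := fun s hs => by
    rw [eq_const_of_offclass P (P M) hconst hper s hs, h.1, htriv]
  have htail := rigid_tail hq (Nat.zero_le _) P (fun t => d t - d (t - 1)) d 0 hoff hPg (fun t _ => rfl)
    (fun k hc => flat_all_of_mass hℓ d hmass _ (fun t h1 h2 => hc t h1 (by omega)))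
  intro t
  rcases Nat.eq_zero_or_pos t with rfl | ht
  · exact htriv
  · exact htail.2 t (by omega)

/-- **Case A, non-trivial centre ⇒ the arm pays `2v+1`.**  If `P v ≠ 0` then
`2v + 1 ≤ Σ_{t ≤ v} |d t| ≤ ℓ`. -/
theorem two_mul_add_one_le_of_caseA {q v M ℓ : ℕ} (hv1 : 1 ≤ v) (hv2 : v ≤ 2 * q) (hℓ : ℓ < 2 * q)
    (d : ℕ → ℤ) (hdM : ∀ t, M ≤ t → d t = 0)
    (hmass : ∀ a, ∑ t ∈ Finset.Ico a (a + 2 * q), |d t| ≤ ℓ)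
    (hread : ∀ t₀, 1 ≤ t₀ → t₀ ≤ M → (t₀ - 1) % (2 * q + 1) ≠ v →
      ∑ t ∈ Finset.Icc t₀ (t₀ + 2 * q), (-1 : ℤ) ^ (t - t₀) * (d t - d (t - 1)) = 0)
    (hnt : ∑ t ∈ Finset.Icc 1 v, (-1 : ℤ) ^ t * (d t - d (t - 1)) ≠ 0)
    (hcost : ∑ t ∈ Finset.range (v + 1), |d t| ≤ ℓ) : 2 * v + 1 ≤ ℓ := by
  obtain ⟨-, hdlow, hd0, hdv, -⟩ := arm_rigid_caseA (q := q) hv1 hv2 hℓ d hdM hmass hread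
  set p := ∑ t ∈ Finset.Icc 1 v, (-1 : ℤ) ^ t * (d t - d (t - 1)) with hp
  have habs1 : |((-1 : ℤ) ^ v)| = 1 := by rw [abs_pow, abs_neg, abs_one, one_pow]
  have hp1 : (1 : ℤ) ≤ |p| := Int.one_le_abs hnt
  have hlow : ∀ t ∈ Finset.range v, (2 : ℤ) ≤ |d t| := by
    intro t ht
    rw [hdlow t (Finset.mem_range.mp ht), hd0, abs_mul, abs_mul, habs1]
    norm_num; linarith
  have hv' : |d v| = |p| := by rw [hdv, abs_neg, abs_mul, habs1, one_mul]
  have hsum : (2 * v : ℤ) + 1 ≤ ∑ t ∈ Finset.range (v + 1), |d t| := by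
    rw [Finset.sum_range_succ]
    have h1 : (2 * v : ℤ) ≤ ∑ t ∈ Finset.range v, |d t| := by
      calc (2 * v : ℤ) = ∑ _t ∈ Finset.range v, (2 : ℤ) := by simp; ring
        _ ≤ ∑ t ∈ Finset.range v, |d t| := Finset.sum_le_sum hlow
    linarith
  have := le_trans hsum hcost
  omega

end Summit.ValiantsHypothesis.ValiantsHypothesis.Theorems.PeelingLemmaRigidity
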